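import Summits.NavierStokesRegularity.FluidComputer.PalasekTowerRegisterGlobalTail
import Summits.NavierStokesRegularity.FluidComputer.PalasekTowerReforce
import Summits.NavierStokesRegularity.FluidComputer.PalasekTowerRegisterPushBudget
import Summits.NavierStokesRegularity.FluidComputer.PalasekTowerRegisterGlobalFirstHitting

/-!
# REGISTER v2.3′: the re-push surgery and the `EpisodeBaseG` split over a DESIGN CLASS of hosts

Cell `ns-blowup`, seat `ns-blowup-ecbridge-4` (g0), ONE WRITER of the re-push surgery and of the
design-class shapes by planner RULING STATUS l.1890 (2026-08-26T02:37Z); §§1–3 are mined, up to names,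
from the draft `PalasekTowerRegisterGlobalBase_designclass_draft.lean` (sha16 0b14cdfce16b7f88) of seat
`ns-blowup-ecbridge-1` (g4), with thanks. Companion of `PalasekTowerRegisterGlobal.lean` (p411629: the
items of record `EpisodeBaseG` / `EpisodeInductionG` of the route `PalasekTowerBreakdown`, items
stmt-NavierStokesRegularity-19179 / -19178), `PalasekTowerRegisterGlobalTail.lean` (p412736: `RungG`),
`PalasekTowerReforce.lean` (p406876: `Schedule.reforce`), `PalasekTowerRegisterPushBudget.lean`
(p418321: every push constant `≤ c₁` passes the pins on rigid wide schedules) and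
`PalasekTowerRegisterGlobalFirstHitting.lean` (p417307: the anchor's bite at `τ₀`). LABEL: E–C typing
(KERNEL vocabulary; NAMED open `Prop`s PARAMETRISED by a design class + their interlocks, every
implication proved). WHAT THIS IS NOT: not Navier–Stokes evidence — no stage, push, host design,
tower or instance is constructed or claimed; the `@[conjecture]` definitions are never asserted, and
NO design class is instantiated here (the tree holds no `ℝ³` level-0 host profile yet).

## Why (planner OBJECTION l.1832, ecbridge-4 OBJECTION l.1875, planner RULING l.1890)

The crux `EpisodeBaseG` is `∃ S ∃ stage at level 1`. Its BC3 split «host preparation ∧ first episode»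
is honest only if the first episode quantifies over a NAMED DESIGN CLASS of hosts: the ∀-schedule form
(`HeredityAt 0`) is the unforced level-0 trap (the class «pinned, rigid, quiet» is closed under
silencing the force after `τ₀`), the re-forcing form keeps the trap on the `c₄ = 0` schedules
(`Schedule.reforce_c₄`), and every ∀-over-ALL-hosts form asserts that EVERY flow meeting the level-0
numbers doubles its global maximum speed (exactly `c₁ Y₀` at `τ₀`, `Stage.norm_τ_zero_le`) inside
`w₀ = c₅ log N₁ / A₀` although any admissible push moves velocities by `≤ 1/4`
(`Schedule.Rigid.push_impulse_le`). This file supplies the vocabulary of the filing shape of record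
(RULING l.1890 (2)):

* §1 `Schedule.repush c hc g …` — replace the force by an admissible `g` AND the push constant by
  `c ≤ c₁`; simp lemmas; what survives: rigidity (`Rigid.repush`), quietness iff `g = 0` from `τ 1`
  (`repush_quiet_iff`), the pins given the impulse inequality for `c` (`Pins.repush`), automatically for
  `c ≤ c₄` (`Pins.repush_of_le`) and — on RIGID schedules on the wide base — for EVERY `c ≤ c₁`
  (`Rigid.pins_repush_of_le_c₁`, by p418321); `reforce_eq_repush`.
* §2 `Margins.routeG_repush` (the v2.3′ margin is force-blind) and the transport `Stage.repushG` of a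
  registered stage whose slab force is unchanged.
* §3 `HostClass` (a predicate on a schedule with a registered level-0 stage), `HostPreparationD D`,
  `FirstEpisodeD D` (repush form: push constant and push chosen after seeing the host, equal to the
  schedule's force on the host's slab, re-pushed schedule again pinned rigid quiet, a registered level-1
  stage continuing the host), the GLUE `episodeBaseG_of_host_firstD : HostPreparationD D →
  FirstEpisodeD D → EpisodeBaseG` for every `D`, monotonicity in `D`, `HostPreparationD D → RungG 0`,
  and the design-free extreme `FirstEpisodeAll := FirstEpisodeD HostClass.any`, docstringed as the
  ∀-hosts TRAP (refuter K-row target, never a filing shape).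
* The DESIGN SLOT itself (class constructors `HostClass.nearC1`, `HostClass.rising`, the register's
  constraints on any preparable design, and the one-line recipe `GoodHost := (nearC1 𝒰 ε₀ ε₁).inter
  (rising κ)`, `FirstEpisodeH := FirstEpisodeD GoodHost`) is the companion file
  `PalasekTowerRegisterGlobalDesignSlot.lean`; no design class is instantiated anywhere (the tree holds
  no `ℝ³` level-0 host profile yet).

References: S. Palasek, arXiv:2605.13827 §3.3–§4 and Rem. 1.4 [cite: Palasek2026ElementaryModel, §4];
C. L. Fefferman, Clay problem description, (C) [cite: FeffermanClay2006, (C)].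
-/

noncomputable section

namespace Summit.NavierStokesRegularity.FluidComputer.PalasekTowerClayBridge

open Set MeasureTheory Filter Topology Function Real
open scoped ENNReal ContDiff NNReal InnerProductSpace RealInnerProductSpace
open Laplacian
open Literature.Analysis.FluidPDE

/-! ## §1 The re-push surgery: new force AND new window push constant -/

namespace Schedule

variable {R : TowerRates} (S : Schedule R)

/-- **Re-pushing a schedule**: replace the force by an admissible `g` (Clay class, silent from `T`) AND
the window push constant by `c ≤ c₁` with `‖g‖ ≤ c Y_k` on every growth window; times, the other
constants, ball, datum and loops are kept. (`Schedule.reforce` is the case `c = S.c₄`; the extra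
freedom matters exactly on schedules registered with `c₄ = 0`, where `reforce` admits only pushes
vanishing on `[τ 0, ∞)`.) [folklore] -/
def repush (c : ℝ) (hc : c ≤ S.c₁) (g : ℝ → EuclideanSpace ℝ (Fin 3) → EuclideanSpace ℝ (Fin 3))
    (h₁ : IsSmoothOnHalfSpace g) (h₂ : HasRapidSpaceTimeDecay g)
    (h₃ : ∀ t, S.T ≤ t → ∀ x, g t x = 0)
    (h₄ : ∀ k, ∀ t ∈ Icc (S.τ k) (S.τ (k + 1)), ∀ x, ‖g t x‖ ≤ c * R.Y k) : Schedule R :=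
  { S with f := g, c₄ := c, c₄_le := hc, force_smooth := h₁, force_decay := h₂, force_silent := h₃,
           push_small := h₄ }

variable {S} {Λ θ : ℝ} {c : ℝ} {hc : c ≤ S.c₁}
  {g : ℝ → EuclideanSpace ℝ (Fin 3) → EuclideanSpace ℝ (Fin 3)}
  {h₁ : IsSmoothOnHalfSpace g} {h₂ : HasRapidSpaceTimeDecay g}
  {h₃ : ∀ t, S.T ≤ t → ∀ x, g t x = 0}
  {h₄ : ∀ k, ∀ t ∈ Icc (S.τ k) (S.τ (k + 1)), ∀ x, ‖g t x‖ ≤ c * R.Y k}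

/-- The re-pushed schedule carries the new force. [folklore] -/
@[simp] theorem repush_f : (S.repush c hc g h₁ h₂ h₃ h₄).f = g := rfl

/-- … and the new push constant. [folklore] -/
@[simp] theorem repush_c₄ : (S.repush c hc g h₁ h₂ h₃ h₄).c₄ = c := rfl

/-- Re-pushing keeps the readout times. [folklore] -/
@[simp] theorem repush_τ : (S.repush c hc g h₁ h₂ h₃ h₄).τ = S.τ := rfl

/-- Re-pushing keeps the blow-up time. [folklore] -/
@[simp] theorem repush_T : (S.repush c hc g h₁ h₂ h₃ h₄).T = S.T := rfl

/-- Re-pushing keeps the datum. [folklore] -/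
@[simp] theorem repush_u₀ : (S.repush c hc g h₁ h₂ h₃ h₄).u₀ = S.u₀ := rfl

/-- Re-pushing keeps the ball. [folklore] -/
@[simp] theorem repush_radius : (S.repush c hc g h₁ h₂ h₃ h₄).radius = S.radius := rfl

/-- Re-pushing keeps the floor constant. [folklore] -/
@[simp] theorem repush_c₁ : (S.repush c hc g h₁ h₂ h₃ h₄).c₁ = S.c₁ := rfl

/-- Re-pushing keeps the ceiling constant. [folklore] -/
@[simp] theorem repush_c₂ : (S.repush c hc g h₁ h₂ h₃ h₄).c₂ = S.c₂ := rfl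

/-- Re-pushing keeps the clock constant. [folklore] -/
@[simp] theorem repush_c₃ : (S.repush c hc g h₁ h₂ h₃ h₄).c₃ = S.c₃ := rfl

/-- Re-pushing keeps the window constant. [folklore] -/
@[simp] theorem repush_c₅ : (S.repush c hc g h₁ h₂ h₃ h₄).c₅ = S.c₅ := rfl

/-- Re-forcing is re-pushing with the old push constant (definitionally). [folklore] -/
theorem reforce_eq_repush
    {h₄' : ∀ k, ∀ t ∈ Icc (S.τ k) (S.τ (k + 1)), ∀ x, ‖g t x‖ ≤ S.c₄ * R.Y k} :
    S.reforce g h₁ h₂ h₃ h₄' = S.repush S.c₄ S.c₄_le g h₁ h₂ h₃ h₄' := rfl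

/-- Rigidity survives re-pushing (it reads times and `c₁, c₂, c₅` only). [folklore] -/
theorem Rigid.repush (h : S.Rigid) : (S.repush c hc g h₁ h₂ h₃ h₄).Rigid :=
  ⟨h.window_eq, h.c₅_eq, h.c₁_eq, h.c₂_eq⟩

/-- The re-pushed schedule is quiet iff the new force vanishes from `τ 1` on. [folklore] -/
theorem repush_quiet_iff : (S.repush c hc g h₁ h₂ h₃ h₄).Quiet ↔ ∀ t, S.τ 1 ≤ t → g t = 0 := Iff.rfl

/-- **The pins of a re-pushed schedule**: the impulse inequality for the NEW push constant, the old
separation and datum confinement, and confinement of the new force. [folklore] -/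
theorem Pins.repush (h : S.Pins Λ θ)
    (himp : ∀ k, Λ * (c * R.Y k) * (S.τ (k + 1) - S.τ k) ≤ S.c₁ * R.Y (k + 1) - S.c₂ * R.Y k)
    (hg : ∀ t x, S.radius < ‖x‖ → g t x = 0) : (S.repush c hc g h₁ h₂ h₃ h₄).Pins Λ θ :=
  ⟨himp, h.sep, h.datum_confined, hg⟩

/-- With `Λ ≥ 0`, a push constant `0 ≤ c ≤ c₄` passes the impulse pin automatically. [folklore] -/
theorem Pins.repush_of_le (h : S.Pins Λ θ) (hΛ : 0 ≤ Λ) (hc0 : 0 ≤ c) (hle : c ≤ S.c₄)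
    (hg : ∀ t x, S.radius < ‖x‖ → g t x = 0) : (S.repush c hc g h₁ h₂ h₃ h₄).Pins Λ θ := by
  refine h.repush (fun k => le_trans ?_ (h.impulse k)) hg
  have hY : 0 < R.Y k := Real.rpow_pos_of_pos (R.N_pos k) _
  have hτ : 0 ≤ S.τ (k + 1) - S.τ k := by linarith [S.τ_lt_succ k]
  have : c * R.Y k ≤ S.c₄ * R.Y k := mul_le_mul_of_nonneg_right hle hY.le
  have hc' : 0 ≤ c * R.Y k := mul_nonneg hc0 hY.le
  nlinarith [mul_le_mul_of_nonneg_right (mul_le_mul_of_nonneg_left this hΛ) hτ]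

end Schedule

/-- **On a RIGID schedule on the wide base EVERY push constant `c ≤ c₁ = 1` keeps the registered pins**
(`Λ = 8`, `θ = 6/5`): the impulse clause by `Schedule.Rigid.impulse_pin_of_le_one` (p418321:
`8 · c Y_k · (τ_{k+1} − τ_k) ≤ 2 ≤ c₁ Y_{k+1} − c₂ Y_k`), the separation by `Schedule.Rigid.sep_wide`,
datum confinement from the old pins, force confinement of the new push. [folklore] -/
theorem Schedule.Rigid.pins_repush_of_le_c₁ {S : Schedule TowerRates.wide} {Λ θ : ℝ} (hR : S.Rigid)
    (hP : S.Pins Λ θ) {c : ℝ} {hc : c ≤ S.c₁}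
    {g : ℝ → EuclideanSpace ℝ (Fin 3) → EuclideanSpace ℝ (Fin 3)}
    {h₁ : IsSmoothOnHalfSpace g} {h₂ : HasRapidSpaceTimeDecay g}
    {h₃ : ∀ t, S.T ≤ t → ∀ x, g t x = 0}
    {h₄ : ∀ k, ∀ t ∈ Icc (S.τ k) (S.τ (k + 1)), ∀ x, ‖g t x‖ ≤ c * TowerRates.wide.Y k}
    (hg : ∀ t x, S.radius < ‖x‖ → g t x = 0) :
    (S.repush c hc g h₁ h₂ h₃ h₄).Pins 8 (6 / 5) := by
  have hc1 : c ≤ 1 := by rw [← hR.c₁_eq]; exact hc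
  exact (Schedule.Rigid.repush hR).pins_of_push_le_one hc1 hP.datum_confined hg

/-! ## §2 The route margin and registered stages under re-pushing -/

/-- **The v2.3′ route margin survives re-pushing** (strain floors, global anchor, rigidity and core
ledger read only times, constants `c₁`, `c₂`, `c₅`, the ball and the velocity). [folklore] -/
theorem Margins.routeG_repush {R : TowerRates} {S : Schedule R} {c : ℝ} {hc : c ≤ S.c₁}
    {g : ℝ → EuclideanSpace ℝ (Fin 3) → EuclideanSpace ℝ (Fin 3)}
    {h₁ : IsSmoothOnHalfSpace g} {h₂ : HasRapidSpaceTimeDecay g}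
    {h₃ : ∀ t, S.T ≤ t → ∀ x, g t x = 0}
    {h₄ : ∀ k, ∀ t ∈ Icc (S.τ k) (S.τ (k + 1)), ∀ x, ‖g t x‖ ≤ c * R.Y k} {k : ℕ}
    {u : ℝ → EuclideanSpace ℝ (Fin 3) → EuclideanSpace ℝ (Fin 3)}
    (h : Margins.routeG R S k u) : Margins.routeG R (S.repush c hc g h₁ h₂ h₃ h₄) k u :=
  ⟨h.1, h.2.1, ⟨h.2.2.1.window_eq, h.2.2.1.c₅_eq, h.2.2.1.c₁_eq, h.2.2.1.c₂_eq⟩, h.2.2.2⟩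

/-- **Transport of a registered stage to a re-pushed schedule** whose force agrees with the old one on
the stage's slab: every clause of `Stage` lives on the slab, the momentum equation reads the force
there only, and the route margin survives the surgery. [folklore] -/
def Stage.repushG {ν : ℝ} {R : TowerRates} {S : Schedule R} {k : ℕ}
    (s : Stage ν R S (Margins.routeG R) k) (c : ℝ) (hc : c ≤ S.c₁)
    (g : ℝ → EuclideanSpace ℝ (Fin 3) → EuclideanSpace ℝ (Fin 3))
    (h₁ : IsSmoothOnHalfSpace g) (h₂ : HasRapidSpaceTimeDecay g)
    (h₃ : ∀ t, S.T ≤ t → ∀ x, g t x = 0)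
    (h₄ : ∀ k, ∀ t ∈ Icc (S.τ k) (S.τ (k + 1)), ∀ x, ‖g t x‖ ≤ c * R.Y k)
    (hg : ∀ t ∈ Icc 0 (S.τ k), ∀ x, g t x = S.f t x) :
    Stage ν R (S.repush c hc g h₁ h₂ h₃ h₄) (Margins.routeG R) k where
  u := s.u
  p := s.p
  classical := by
    refine ⟨s.classical.smooth_velocity, s.classical.smooth_pressure, ?_, s.classical.divFree⟩
    intro t ht x
    have hmom := s.classical.momentum t ht x
    simp only [Schedule.repush_f]
    rw [hg t ht x]
    exact hmom
  initial := s.initial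
  energy := s.energy
  floor := s.floor
  ceiling := s.ceiling
  quiet := s.quiet
  margin := Margins.routeG_repush s.margin

/-- The transported stage has the same velocity. [folklore] -/
@[simp] theorem Stage.repushG_u {ν : ℝ} {R : TowerRates} {S : Schedule R} {k : ℕ}
    (s : Stage ν R S (Margins.routeG R) k) (c : ℝ) (hc : c ≤ S.c₁)
    (g : ℝ → EuclideanSpace ℝ (Fin 3) → EuclideanSpace ℝ (Fin 3))
    (h₁ : IsSmoothOnHalfSpace g) (h₂ : HasRapidSpaceTimeDecay g)
    (h₃ : ∀ t, S.T ≤ t → ∀ x, g t x = 0)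
    (h₄ : ∀ k, ∀ t ∈ Icc (S.τ k) (S.τ (k + 1)), ∀ x, ‖g t x‖ ≤ c * R.Y k)
    (hg : ∀ t ∈ Icc 0 (S.τ k), ∀ x, g t x = S.f t x) :
    (s.repushG c hc g h₁ h₂ h₃ h₄ hg).u = s.u := rfl

/-- The transported stage has the same pressure. [folklore] -/
@[simp] theorem Stage.repushG_p {ν : ℝ} {R : TowerRates} {S : Schedule R} {k : ℕ}
    (s : Stage ν R S (Margins.routeG R) k) (c : ℝ) (hc : c ≤ S.c₁)
    (g : ℝ → EuclideanSpace ℝ (Fin 3) → EuclideanSpace ℝ (Fin 3))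
    (h₁ : IsSmoothOnHalfSpace g) (h₂ : HasRapidSpaceTimeDecay g)
    (h₃ : ∀ t, S.T ≤ t → ∀ x, g t x = 0)
    (h₄ : ∀ k, ∀ t ∈ Icc (S.τ k) (S.τ (k + 1)), ∀ x, ‖g t x‖ ≤ c * R.Y k)
    (hg : ∀ t ∈ Icc 0 (S.τ k), ∀ x, g t x = S.f t x) :
    (s.repushG c hc g h₁ h₂ h₃ h₄ hg).p = s.p := rfl

/-! ## §3 The `EpisodeBaseG` split over a design class of hosts -/

/-- **A design class of level-0 hosts**: a predicate on (pinned rigid quiet) schedules on the wide-base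
rates together with a globally anchored registered level-0 stage — the slot for the filer's NAMED host
design (profile family, tolerances; see §4); `HostClass.any` admits every host. [folklore] -/
def HostClass : Type :=
  (S : Schedule TowerRates.wide) → Stage 1 TowerRates.wide S (Margins.routeG TowerRates.wide) 0 → Prop

/-- The class of ALL registered hosts. [folklore] -/
def HostClass.any : HostClass := fun _ _ => True

/-- Intersection of design classes (conjunction of requirements). [folklore] -/
def HostClass.inter (D D' : HostClass) : HostClass := fun S s₀ => D S s₀ ∧ D' S s₀

/-- **HOST PREPARATION IN THE CLASS `D`** (open for every non-trivial `D`; never asserted): some pinned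
(`Λ = 8`, `θ = 6/5`), rigid, quiet schedule on the wide-base rates carries a globally anchored
registered level-0 stage lying in the design class `D` — the DESIGN is prepared (free push on
`[0, τ₀)`, readout at the first hitting time `τ₀` of the speed `c₁ Y₀`). [cite: Palasek2026ElementaryModel, §3.3] -/
@[conjecture] def HostPreparationD (D : HostClass) : Prop :=
  ∃ (S : Schedule TowerRates.wide)
    (s₀ : Stage 1 TowerRates.wide S (Margins.routeG TowerRates.wide) 0),
    S.Pins 8 (6 / 5) ∧ S.Rigid ∧ S.Quiet ∧ D S s₀

/-- **THE FIRST EPISODE OVER THE CLASS `D`** (open; never asserted): for every pinned (`Λ = 8`,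
`θ = 6/5`), rigid, quiet schedule `S` on the wide-base rates and every globally anchored registered
LEVEL-0 stage `s₀` of it IN THE CLASS `D`, there are a window push constant `c ≤ c₁` and an ADMISSIBLE
PUSH `g` — Clay-smooth on the closed half-space with Fefferman's decay, silent from `T`, `‖g‖ ≤ c Y_k`
on the growth windows, EQUAL to `S.f` on the host's slab `[0, τ 0] × ℝ³`, the re-pushed schedule again
pinned, rigid and quiet (`g = 0` from `τ 1` on) — under which the host continues to a registered LEVEL-1
stage: the first compaction `0 → 1` (`N₀ = 256 → N₁ ≈ 445`, window `c₅ log N₁ / A₀`, floor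
`c₁ Y₁ ≥ 2 c₁ Y₀`) as a FORCED episode whose push the prover chooses after seeing the host. Honest
numbers: any `c ≤ c₁ = 1` passes the pins (`Schedule.Rigid.pins_repush_of_le_c₁`) and its push moves
velocities by at most `1/4` on window `0` (`Schedule.Rigid.push_impulse_le`), against a jump of the
global maximum speed from exactly `c₁ Y₀ ≈ 1351` to `≥ c₁ Y₁ ≈ 2778` (`Stage.first_jump`): the content
is that the DESIGNED flow's own dynamics makes the level-1 readouts; with `D = HostClass.any` this is
asked of EVERY registered host (`FirstEpisodeAll`, the trap). [cite: Palasek2026ElementaryModel, §3.3 and Rem. 1.4] -/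
@[conjecture] def FirstEpisodeD (D : HostClass) : Prop :=
  ∀ S : Schedule TowerRates.wide, S.Pins 8 (6 / 5) → S.Rigid → S.Quiet →
    ∀ s₀ : Stage 1 TowerRates.wide S (Margins.routeG TowerRates.wide) 0, D S s₀ →
      ∃ (c : ℝ) (hc : c ≤ S.c₁) (g : ℝ → EuclideanSpace ℝ (Fin 3) → EuclideanSpace ℝ (Fin 3))
        (h₁ : IsSmoothOnHalfSpace g) (h₂ : HasRapidSpaceTimeDecay g)
        (h₃ : ∀ t, S.T ≤ t → ∀ x, g t x = 0)
        (h₄ : ∀ k, ∀ t ∈ Icc (S.τ k) (S.τ (k + 1)), ∀ x, ‖g t x‖ ≤ c * TowerRates.wide.Y k),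
        (∀ t ∈ Icc 0 (S.τ 0), ∀ x, g t x = S.f t x) ∧
        (S.repush c hc g h₁ h₂ h₃ h₄).Pins 8 (6 / 5) ∧ (S.repush c hc g h₁ h₂ h₃ h₄).Rigid ∧
        (S.repush c hc g h₁ h₂ h₃ h₄).Quiet ∧
        ∃ s₁ : Stage 1 TowerRates.wide (S.repush c hc g h₁ h₂ h₃ h₄) (Margins.routeG TowerRates.wide) 1,
          ∀ t ∈ Icc 0 (S.τ 0), s₁.u t = s₀.u t ∧ s₁.p t = s₀.p t

/-- **GLUE of the `EpisodeBase` split, for every design class (kernel-checked against the landed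
register)**: host preparation in `D` and the first episode over `D` give K1G — take the host, re-push
by the chosen constant and push; the level-1 stage of the re-pushed (pinned, rigid, quiet) schedule
witnesses `EpisodeBaseG`. Explicit binders in the order
`HostPreparationD D → FirstEpisodeD D → EpisodeBaseG`. [folklore] -/
theorem episodeBaseG_of_host_firstD (D : HostClass) (hH : HostPreparationD D) (hF : FirstEpisodeD D) :
    EpisodeBaseG := by
  obtain ⟨S, s₀, hP, hR, hQ, hD⟩ := hH
  obtain ⟨c, hc, g, h₁, h₂, h₃, h₄, -, hP', hR', hQ', s₁, -⟩ := hF S hP hR hQ s₀ hD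
  exact ⟨S.repush c hc g h₁ h₂ h₃ h₄, hP', hR', hQ', ⟨s₁⟩⟩

/-- Host preparation in a class is monotone in the class. [folklore] -/
theorem HostPreparationD.mono {D D' : HostClass} (hDD' : ∀ S s₀, D S s₀ → D' S s₀)
    (h : HostPreparationD D) : HostPreparationD D' := by
  obtain ⟨S, s₀, hP, hR, hQ, hD⟩ := h
  exact ⟨S, s₀, hP, hR, hQ, hDD' S s₀ hD⟩

/-- The first episode over a class is antitone in the class (a smaller design class is a weaker claim).
[folklore] -/
theorem FirstEpisodeD.anti {D D' : HostClass} (hDD' : ∀ S s₀, D S s₀ → D' S s₀)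
    (h : FirstEpisodeD D') : FirstEpisodeD D :=
  fun S hP hR hQ s₀ hD => h S hP hR hQ s₀ (hDD' S s₀ hD)

/-- Host preparation in any class gives rung `0` of the v2.3′ ladder (the planner's `HostPreparation`).
[folklore] -/
theorem HostPreparationD.rungG_zero {D : HostClass} (h : HostPreparationD D) : RungG 0 := by
  obtain ⟨S, s₀, hP, hR, hQ, -⟩ := h
  exact ⟨S, hP, hR, hQ, ⟨s₀⟩⟩

/-- Rung `0` is host preparation in the class of all hosts. [folklore] -/
theorem hostPreparationD_any_iff_rungG_zero : HostPreparationD HostClass.any ↔ RungG 0 :=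
  ⟨HostPreparationD.rungG_zero, fun ⟨S, hP, hR, hQ, ⟨s₀⟩⟩ => ⟨S, s₀, hP, hR, hQ, trivial⟩⟩

/-- Host preparation in an intersection gives it in each factor. [folklore] -/
theorem HostPreparationD.of_inter_left {D D' : HostClass} (h : HostPreparationD (D.inter D')) :
    HostPreparationD D :=
  h.mono fun _ _ hx => hx.1

/-- … and in the other factor. [folklore] -/
theorem HostPreparationD.of_inter_right {D D' : HostClass} (h : HostPreparationD (D.inter D')) :
    HostPreparationD D' :=
  h.mono fun _ _ hx => hx.2

/-- **THE FIRST EPISODE FOR EVERY HOST — the ∀-hosts TRAP** (open; never asserted; NOT a filing shape,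
planner RULING STATUS l.1890): the design-free extreme `FirstEpisodeD HostClass.any` — every registered
level-0 host of every pinned rigid quiet schedule is pushed to level 1 by SOME admissible re-push.
Declared exposure (ecbridge-4 OBJECTION l.1875 (3), refuter K37): the `∀` includes adversarial minimal
hosts — one viscous-scale structure meeting the three level-0 floors marginally, global speed maximum
exactly `c₁ Y₀` at `τ 0` (`Stage.exists_firstHitting`) — of which a speed DOUBLING inside
`w₀ = c₅ log N₁ / A₀` is asked while any admissible push contributes at most `1/4` directly
(`Schedule.Rigid.push_impulse_le`); a single provably decaying registered host refutes it (modulo forced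
uniqueness and a decay estimate on `ℝ³`). [cite: Palasek2026ElementaryModel, §3.3] -/
@[conjecture] def FirstEpisodeAll : Prop := FirstEpisodeD HostClass.any

/-- The design-free pair composes to K1G (`episodeBaseG_of_host_firstD` at `HostClass.any`). [folklore] -/
theorem episodeBaseG_of_rungG_zero_firstAll (hH : RungG 0) (hF : FirstEpisodeAll) : EpisodeBaseG :=
  episodeBaseG_of_host_firstD HostClass.any (hostPreparationD_any_iff_rungG_zero.2 hH) hF

/-- The first episode for every host gives it for every class. [folklore] -/
theorem FirstEpisodeAll.firstEpisodeD (h : FirstEpisodeAll) (D : HostClass) : FirstEpisodeD D :=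
  FirstEpisodeD.anti (D' := HostClass.any) (fun _ _ _ => trivial) h

end Summit.NavierStokesRegularity.FluidComputer.PalasekTowerClayBridge

end
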